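import Mathlib.Analysis.Complex.ExponentialBounds
import Literature.Analysis.FluidPDE.ClassicalL2StabilityStrain
import HarnessLib

/-!
# The continuity method for energy inequalities with a square-root forcing and a superlinear
# production (Robinson–Rodrigo–Sadowski 2016, proof of Thm. 9.1, Steps 2–3; Lemma 9.2)

Analysis/FluidPDE proof file (theorems only; no definitions, no named facts, no `sorry`). The
real-analysis core of every a-posteriori ("robustness of regularity") door: an energy `φ ≥ 0` of the
difference of two flows obeys, in integrated form,

  `φ(t) ≤ φ(0) + ∫₀ᵗ (2G φ + 2R √φ + β φᵖ)`     (`p ≥ 1`, `β ≥ 0`, `G, R ≥ 0` continuous)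

— linear production at the (strain) rate `G`, forcing `R` (the residual of the reference, entering
through Cauchy–Schwarz as `2R√φ`), and the superlinear remainder `βφᵖ` of the cubic term after the
dissipation has been used (`p = 3` in Robinson–Rodrigo–Sadowski (9.2) with `φ = ‖∇w‖²`; `p = 2` or
`5/3` for weighted `L² ⊕ Ḣ¹ ⊕ Ḣ²` energies). With `M(t) = (√φ(0) + ∫₀ᵗ R)·exp(∫₀ᵗ G)` (the bound of the
LINEAR problem, `sqrt_le_mul_exp_of_le_add_intervalIntegral`):

* `lt_of_continuity_method` — the first-bad-time argument: `φ` continuous on `[0, T]`, `φ(0) < L`, and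
  "`φ ≤ L` on `[0, t₁]` implies `φ < L` on `[0, t₁]`" for every `t₁ ≤ T` ⟹ `φ < L` on `[0, T]`;
* `sqrt_le_two_mul_exp_of_le_add_intervalIntegral_rpow` — under the SMALLNESS
  `β · (4 M(T)²)^{p−1} · T ≤ 1`: `√φ(t) ≤ 2 M(t)` on `[0, T]` (indeed `≤ e^{1/2} M(t)`): on the bootstrap
  level `L = 4M(T)²` the remainder is linear with rate `βL^{p−1} ≤ 1/T`, so the linear bound inflates
  by at most `e^{1/2}` and stays below `L` (`e < 4`), and the continuity method closes.

This is Robinson–Rodrigo–Sadowski's Step 2–3 of the proof of Thm. 9.1 (integrating factor, then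
comparison with `Ẏ = βY³`, "if `Y(0) < 1/√(2βT)` … `w` does not blow up at any time `T* ≤ T`") and
their ODE Lemma 9.2, in the integrated (no derivative of `φ`) and general-power form the tree's
slice bounds deliver.

## References

* J. C. Robinson, J. L. Rodrigo, W. Sadowski, *The Three-Dimensional Navier–Stokes Equations*,
  CUP 2016, Thm. 9.1 (proof, Steps 2–3), Lemma 9.2, Lemma A.24/A.25. [RobinsonRodrigoSadowski2016]
-/

noncomputable section

open MeasureTheory Set Filter
open _root_.Topology
open scoped ENNReal NNReal

namespace Literature.Analysis.FluidPDE

/-- **The first-bad-time argument (continuity method).** Let `φ` be continuous on `[0, T]` with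
`φ(0) < L`, and suppose that for every `t₁ ∈ [0, T]` the bootstrap hypothesis "`φ ≤ L` on `[0, t₁]`"
implies the strict bound "`φ < L` on `[0, t₁]`". Then `φ < L` on `[0, T]` (at the infimum `t₁` of the
closed set `{φ ≥ L}` one has `φ ≤ L` on `[0, t₁]` by continuity, hence `φ(t₁) < L`, a contradiction).
[cite: RobinsonRodrigoSadowski2016, Thm. 9.1 (proof, Step 3: "w does not blow up at any time T* ≤ T")] -/
theorem lt_of_continuity_method {T L : ℝ} {φ : ℝ → ℝ} (hφc : ContinuousOn φ (Icc 0 T))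
    (h0 : φ 0 < L)
    (H : ∀ t₁ ∈ Icc 0 T, (∀ t ∈ Icc 0 t₁, φ t ≤ L) → ∀ t ∈ Icc 0 t₁, φ t < L) :
    ∀ t ∈ Icc 0 T, φ t < L := by
  by_contra hcon
  push Not at hcon
  obtain ⟨t', ht', hLt'⟩ := hcon
  set S : Set ℝ := Icc 0 T ∩ φ ⁻¹' (Ici L) with hS
  have hSne : S.Nonempty := ⟨t', ht', hLt'⟩
  have hSbdd : BddBelow S := ⟨0, fun t ht => ht.1.1⟩
  have hSclosed : IsClosed S := hφc.preimage_isClosed_of_isClosed isClosed_Icc isClosed_Ici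
  set t₁ := sInf S with ht₁
  have ht₁S : t₁ ∈ S := hSclosed.csInf_mem hSne hSbdd
  have ht₁I : t₁ ∈ Icc 0 T := ht₁S.1
  have hLt₁ : L ≤ φ t₁ := ht₁S.2
  -- before `t₁` the bound is strict
  have hlt : ∀ t ∈ Icc 0 T, t < t₁ → φ t < L := by
    intro t ht htt
    by_contra hge
    push Not at hge
    have : t₁ ≤ t := csInf_le hSbdd ⟨ht, hge⟩
    linarith
  -- `t₁ > 0`
  have ht₁pos : 0 < t₁ := by
    rcases eq_or_lt_of_le ht₁I.1 with h | h
    · rw [← h] at hLt₁; linarith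
    · exact h
  -- `φ t₁ ≤ L` by continuity from the left
  have hle : φ t₁ ≤ L := by
    by_contra hgt
    push Not at hgt
    have hcw : ContinuousWithinAt φ (Icc 0 T) t₁ := hφc t₁ ht₁I
    have hev : ∀ᶠ t in 𝓝[Icc 0 T] t₁, L < φ t := hcw.eventually (Ioi_mem_nhds hgt)
    have hmono : 𝓝[Ico 0 t₁] t₁ ≤ 𝓝[Icc 0 T] t₁ :=
      nhdsWithin_mono _ fun t ht => ⟨ht.1, ht.2.le.trans ht₁I.2⟩
    have hev' : ∀ᶠ t in 𝓝[Ico 0 t₁] t₁, L < φ t ∧ t ∈ Ico 0 t₁ :=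
      (hev.filter_mono hmono).and eventually_mem_nhdsWithin
    haveI : (𝓝[Ico 0 t₁] t₁).NeBot := by
      refine mem_closure_iff_nhdsWithin_neBot.1 ?_
      rw [closure_Ico ht₁pos.ne]
      exact ⟨ht₁pos.le, le_rfl⟩
    obtain ⟨t, hLt, htI⟩ := hev'.exists
    have htT : t ∈ Icc 0 T := ⟨htI.1, htI.2.le.trans ht₁I.2⟩
    exact absurd (hlt t htT htI.2) (not_lt.2 hLt.le)
  have hboot : ∀ t ∈ Icc 0 t₁, φ t ≤ L := by
    intro t ht
    rcases eq_or_lt_of_le ht.2 with h | h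
    · rw [h]; exact hle
    · exact (hlt t ⟨ht.1, h.le.trans ht₁I.2⟩ h).le
  have := H t₁ ht₁I hboot t₁ ⟨ht₁I.1, le_rfl⟩
  linarith

/-- **The continuity method for `φ ≤ φ₀ + ∫(2Gφ + 2R√φ + βφᵖ)`.** Let `φ ≥ 0`, `G ≥ 0`, `R ≥ 0` be
continuous on `[0, T]`, `β ≥ 0`, `p ≥ 1`, and
`φ(t) ≤ φ(0) + ∫₀ᵗ (2G φ + 2R √φ + β φᵖ)` for `t ∈ [0, T]`. Put `M(t) = (√φ(0) + ∫₀ᵗ R) exp(∫₀ᵗ G)`.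
If `β (4M(T)²)^{p−1} T ≤ 1`, then `√φ(t) ≤ 2 M(t)` on `[0, T]`. Proof: on a bootstrap interval where
`φ ≤ L := 4M(T)²` one has `βφᵖ ≤ βL^{p−1}φ`, so `sqrt_le_mul_exp_of_le_add_intervalIntegral` with the rate
`G + βL^{p−1}/2` gives `√φ ≤ M(t) e^{βL^{p−1}t/2} ≤ e^{1/2} M(T)`, i.e. `φ ≤ e M(T)² < L`; the continuity
method (`lt_of_continuity_method`) removes the bootstrap hypothesis. (Robinson–Rodrigo–Sadowski:
integrating factor `X = e^{−∫α}‖∇w‖²`, `Ẋ ≤ βX³`, comparison with `Ẏ = βY³` under `Y(0) < 1/√(2βT)`.)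
[cite: RobinsonRodrigoSadowski2016, Thm. 9.1 (proof, Steps 2–3) and Lemma 9.2] -/
theorem sqrt_le_two_mul_exp_of_le_add_intervalIntegral_rpow {T : ℝ} (hT : 0 ≤ T) {φ G R : ℝ → ℝ}
    {β p : ℝ} (hφc : ContinuousOn φ (Icc 0 T)) (hφ0 : ∀ t ∈ Icc 0 T, 0 ≤ φ t)
    (hGc : ContinuousOn G (Icc 0 T)) (hRc : ContinuousOn R (Icc 0 T))
    (hG0 : ∀ t ∈ Icc 0 T, 0 ≤ G t) (hR0 : ∀ t ∈ Icc 0 T, 0 ≤ R t) (hβ : 0 ≤ β) (hp : 1 ≤ p)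
    (hle : ∀ t ∈ Icc 0 T, φ t ≤ φ 0 +
      ∫ s in (0 : ℝ)..t, (2 * G s * φ s + 2 * R s * Real.sqrt (φ s) + β * φ s ^ p))
    (hthr : β * (4 * ((Real.sqrt (φ 0) + ∫ s in (0 : ℝ)..T, R s) *
        Real.exp (∫ s in (0 : ℝ)..T, G s)) ^ 2) ^ (p - 1) * T ≤ 1) :
    ∀ t ∈ Icc 0 T, Real.sqrt (φ t) ≤
      2 * ((Real.sqrt (φ 0) + ∫ s in (0 : ℝ)..t, R s) * Real.exp (∫ s in (0 : ℝ)..t, G s)) := by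
  -- the linear bound `M`
  obtain ⟨M, hMdef⟩ : ∃ M : ℝ → ℝ, M = fun t =>
      (Real.sqrt (φ 0) + ∫ s in (0 : ℝ)..t, R s) * Real.exp (∫ s in (0 : ℝ)..t, G s) := ⟨_, rfl⟩
  have hMt : ∀ t, M t = (Real.sqrt (φ 0) + ∫ s in (0 : ℝ)..t, R s) * Real.exp (∫ s in (0 : ℝ)..t, G s) :=
    fun t => by rw [hMdef]
  have hM0 : M 0 = Real.sqrt (φ 0) := by
    rw [hMt, intervalIntegral.integral_same, intervalIntegral.integral_same, add_zero, Real.exp_zero,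
      mul_one]
  have hRi : IntervalIntegrable R volume 0 T := hRc.intervalIntegrable_of_Icc hT
  have hGi : IntervalIntegrable G volume 0 T := hGc.intervalIntegrable_of_Icc hT
  have hR_ae : 0 ≤ᵐ[volume.restrict (Ioc 0 T)] R :=
    (ae_restrict_iff' measurableSet_Ioc).2 (Eventually.of_forall fun s hs =>
      hR0 s (Ioc_subset_Icc_self hs))
  have hG_ae : 0 ≤ᵐ[volume.restrict (Ioc 0 T)] G :=
    (ae_restrict_iff' measurableSet_Ioc).2 (Eventually.of_forall fun s hs =>
      hG0 s (Ioc_subset_Icc_self hs))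
  have hIntR : ∀ t ∈ Icc 0 T, 0 ≤ ∫ s in (0 : ℝ)..t, R s := fun t ht =>
    intervalIntegral.integral_nonneg ht.1 fun s hs => hR0 s ⟨hs.1, hs.2.trans ht.2⟩
  have hMnn : ∀ t ∈ Icc 0 T, 0 ≤ M t := fun t ht => by
    rw [hMt]; exact mul_nonneg (add_nonneg (Real.sqrt_nonneg _) (hIntR t ht)) (Real.exp_nonneg _)
  have hMle : ∀ t ∈ Icc 0 T, M t ≤ M T := by
    intro t ht
    rw [hMt, hMt]
    have h1 : ∫ s in (0 : ℝ)..t, R s ≤ ∫ s in (0 : ℝ)..T, R s :=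
      intervalIntegral.integral_mono_interval le_rfl ht.1 ht.2 hR_ae hRi
    have h2 : ∫ s in (0 : ℝ)..t, G s ≤ ∫ s in (0 : ℝ)..T, G s :=
      intervalIntegral.integral_mono_interval le_rfl ht.1 ht.2 hG_ae hGi
    exact mul_le_mul (by linarith) (Real.exp_le_exp.2 h2) (Real.exp_nonneg _)
      (add_nonneg (Real.sqrt_nonneg _) ((hIntR t ht).trans h1))
  rw [← hMt T] at hthr
  -- the bootstrap step: on `[0, t₁]`, `φ ≤ L` (with `L ≥ 0`) gives `√φ ≤ M(t) exp(βL^{p-1}t/2)`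
  have boot : ∀ t₁ ∈ Icc 0 T, ∀ L : ℝ, 0 ≤ L → (∀ t ∈ Icc 0 t₁, φ t ≤ L) →
      ∀ t ∈ Icc 0 t₁, Real.sqrt (φ t) ≤ M t * Real.exp (β * L ^ (p - 1) * t / 2) := by
    intro t₁ ht₁ L hL hbound t ht
    have hsub : Icc 0 t₁ ⊆ Icc 0 T := Icc_subset_Icc le_rfl ht₁.2
    -- the remainder is linear on the bootstrap interval
    have hpow : ∀ s ∈ Icc 0 t₁, β * φ s ^ p ≤ β * L ^ (p - 1) * φ s := by
      intro s hs
      have hφs : 0 ≤ φ s := hφ0 s (hsub hs)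
      have h1 : φ s ^ p = φ s ^ (p - 1) * φ s := by
        conv_lhs => rw [show p = (p - 1) + 1 by ring]
        rw [Real.rpow_add' hφs (by linarith), Real.rpow_one]
      have h2 : φ s ^ (p - 1) ≤ L ^ (p - 1) :=
        Real.rpow_le_rpow hφs (hbound s hs) (by linarith)
      rw [h1, mul_assoc]
      exact mul_le_mul_of_nonneg_left (mul_le_mul_of_nonneg_right h2 hφs) hβ
    have hle' : ∀ t ∈ Icc 0 t₁, φ t ≤ φ 0 + ∫ s in (0 : ℝ)..t,
        (2 * (G s + β * L ^ (p - 1) / 2) * φ s + 2 * R s * Real.sqrt (φ s)) := by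
      intro t ht
      have h := hle t (hsub ht)
      have hφc' : ContinuousOn φ (Icc 0 t) := hφc.mono (Icc_subset_Icc le_rfl (ht.2.trans ht₁.2))
      have hGc' : ContinuousOn G (Icc 0 t) := hGc.mono (Icc_subset_Icc le_rfl (ht.2.trans ht₁.2))
      have hRc' : ContinuousOn R (Icc 0 t) := hRc.mono (Icc_subset_Icc le_rfl (ht.2.trans ht₁.2))
      have hφp : ContinuousOn (fun s => φ s ^ p) (Icc 0 t) :=
        hφc'.rpow_const fun s _ => Or.inr (by linarith)
      have c1 : ContinuousOn (fun s => 2 * G s * φ s + 2 * R s * Real.sqrt (φ s) + β * φ s ^ p) (Icc 0 t) :=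
        (((continuousOn_const.mul hGc').mul hφc').add ((continuousOn_const.mul hRc').mul hφc'.sqrt)).add
          (continuousOn_const.mul hφp)
      have c2 : ContinuousOn (fun s => 2 * (G s + β * L ^ (p - 1) / 2) * φ s + 2 * R s * Real.sqrt (φ s))
          (Icc 0 t) :=
        ((continuousOn_const.mul (hGc'.add continuousOn_const)).mul hφc').add
          ((continuousOn_const.mul hRc').mul hφc'.sqrt)
      have hmono : ∫ s in (0 : ℝ)..t, (2 * G s * φ s + 2 * R s * Real.sqrt (φ s) + β * φ s ^ p) ≤
          ∫ s in (0 : ℝ)..t, (2 * (G s + β * L ^ (p - 1) / 2) * φ s + 2 * R s * Real.sqrt (φ s)) := by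
        refine intervalIntegral.integral_mono_on ht.1 (c1.intervalIntegrable_of_Icc ht.1)
          (c2.intervalIntegrable_of_Icc ht.1) fun s hs => ?_
        have := hpow s ⟨hs.1, hs.2.trans ht.2⟩
        nlinarith
      linarith
    have hG0' : ∀ s ∈ Icc 0 t₁, 0 ≤ G s + β * L ^ (p - 1) / 2 := fun s hs =>
      add_nonneg (hG0 s (hsub hs)) (by positivity)
    have hGc'' : ContinuousOn (fun s => G s + β * L ^ (p - 1) / 2) (Icc 0 t₁) :=
      (hGc.mono hsub).add continuousOn_const
    have h := sqrt_le_mul_exp_of_le_add_intervalIntegral (G := fun s => G s + β * L ^ (p - 1) / 2)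
      (hφc.mono hsub) (fun s hs => hφ0 s (hsub hs)) hGc'' (hRc.mono hsub) hG0'
      (fun s hs => hR0 s (hsub hs)) hle' t ht
    have hsplit : ∫ s in (0 : ℝ)..t, (G s + β * L ^ (p - 1) / 2) =
        (∫ s in (0 : ℝ)..t, G s) + β * L ^ (p - 1) * t / 2 := by
      rw [intervalIntegral.integral_add ((hGc.mono (Icc_subset_Icc le_rfl
          (ht.2.trans ht₁.2))).intervalIntegrable_of_Icc ht.1) intervalIntegrable_const,
        intervalIntegral.integral_const, smul_eq_mul]
      ring
    rw [hsplit, Real.exp_add, ← mul_assoc] at h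
    rw [hMt]
    exact h
  -- `e^{1/2} ≤ 2`
  have hexp_half : Real.exp (1 / 2) ≤ 2 := by
    have h1 : Real.exp (1 / 2) * Real.exp (1 / 2) = Real.exp 1 := by
      rw [← Real.exp_add]; norm_num
    nlinarith [Real.exp_one_lt_d9, Real.exp_pos (1 / 2 : ℝ)]
  -- two cases: `M T = 0` (then everything vanishes) or `M T > 0`
  rcases eq_or_lt_of_le (hMnn T ⟨hT, le_rfl⟩) with hMT0 | hMTpos
  · -- degenerate case: bootstrap at level `L = 1`
    have hMz : ∀ t ∈ Icc 0 T, M t = 0 := fun t ht =>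
      le_antisymm (by rw [hMT0]; exact hMle t ht) (hMnn t ht)
    have hφ0lt : φ 0 < 1 := by
      have : Real.sqrt (φ 0) = 0 := by rw [← hM0]; exact hMz 0 ⟨le_rfl, hT⟩
      rw [Real.sqrt_eq_zero (hφ0 0 ⟨le_rfl, hT⟩)] at this
      rw [this]; norm_num
    have hall : ∀ t ∈ Icc 0 T, φ t < 1 := by
      refine lt_of_continuity_method hφc hφ0lt fun t₁ ht₁ hb t ht => ?_
      have h := boot t₁ ht₁ 1 zero_le_one hb t ht
      rw [hMz t ⟨ht.1, ht.2.trans ht₁.2⟩, zero_mul] at h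
      have hz : φ t = 0 := by
        have := Real.sqrt_eq_zero'.1 (le_antisymm h (Real.sqrt_nonneg _))
        exact le_antisymm this (hφ0 t ⟨ht.1, ht.2.trans ht₁.2⟩)
      rw [hz]; norm_num
    intro t ht
    have h := boot T ⟨hT, le_rfl⟩ 1 zero_le_one (fun s hs => (hall s hs).le) t ht
    rw [hMz t ht, zero_mul] at h
    rw [← hMt, hMz t ht, mul_zero]
    exact h
  · -- main case: bootstrap at level `L = 4 M(T)²`
    set L : ℝ := 4 * M T ^ 2 with hL
    have hL0 : 0 ≤ L := by positivity
    have hφ0lt : φ 0 < L := by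
      have h1 : φ 0 = M 0 ^ 2 := by rw [hM0, Real.sq_sqrt (hφ0 0 ⟨le_rfl, hT⟩)]
      have h2 : M 0 ≤ M T := hMle 0 ⟨le_rfl, hT⟩
      have h3 : 0 ≤ M 0 := hMnn 0 ⟨le_rfl, hT⟩
      rw [h1, hL]
      nlinarith
    -- the inflation factor on a bootstrap interval is at most `e^{1/2}`
    have hrate : ∀ t ∈ Icc 0 T, Real.exp (β * L ^ (p - 1) * t / 2) ≤ Real.exp (1 / 2) := by
      intro t ht
      refine Real.exp_le_exp.2 ?_
      have h1 : β * L ^ (p - 1) * t ≤ β * L ^ (p - 1) * T :=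
        mul_le_mul_of_nonneg_left ht.2 (by positivity)
      have h2 : β * L ^ (p - 1) * T ≤ 1 := by rw [hL]; exact hthr
      linarith
    have hall : ∀ t ∈ Icc 0 T, φ t < L := by
      refine lt_of_continuity_method hφc hφ0lt fun t₁ ht₁ hb t ht => ?_
      have htT : t ∈ Icc 0 T := ⟨ht.1, ht.2.trans ht₁.2⟩
      have h := boot t₁ ht₁ L hL0 hb t ht
      have h1 : Real.sqrt (φ t) ≤ M T * Real.exp (1 / 2) :=
        h.trans (mul_le_mul (hMle t htT) (hrate t htT) (Real.exp_nonneg _) (hMnn T ⟨hT, le_rfl⟩))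
      have h2 : φ t = Real.sqrt (φ t) ^ 2 := (Real.sq_sqrt (hφ0 t htT)).symm
      have h3 : (M T * Real.exp (1 / 2)) ^ 2 < L := by
        rw [hL, mul_pow]
        have : Real.exp (1 / 2) ^ 2 = Real.exp 1 := by
          rw [sq, ← Real.exp_add]; norm_num
        rw [this]
        nlinarith [Real.exp_one_lt_d9, hMTpos]
      rw [h2]
      exact lt_of_le_of_lt (pow_le_pow_left₀ (Real.sqrt_nonneg _) h1 2) h3
    intro t ht
    have h := boot T ⟨hT, le_rfl⟩ L hL0 (fun s hs => (hall s hs).le) t ht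
    rw [← hMt]
    calc Real.sqrt (φ t) ≤ M t * Real.exp (β * L ^ (p - 1) * t / 2) := h
      _ ≤ M t * 2 := mul_le_mul_of_nonneg_left ((hrate t ht).trans hexp_half) (hMnn t ht)
      _ = 2 * M t := mul_comm _ _

end Literature.Analysis.FluidPDE

end
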